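import Summits.QuantumFields.YangMills.Theorems.FluctuationComparisonRegPrIntLS2BetaSeamTwistDescent
import Summits.QuantumFields.YangMills.Theorems.FluctuationComparisonRegPrIntLS2BetaTubeLettersOrbitTransport
import Summits.QuantumFields.YangMills.Theorems.FluctuationComparisonRegPrIntLS2BetaFlatGapOutright
import Summits.QuantumFields.YangMills.Theorems.FluctuationComparisonRegPrIntLS2BetaCriticalOrbitUnique
import HarnessLib

/-!
# (RG-K) THE ℤ₂ SEAM TWIST, III — the (T)-chain's tube letters under the seam twist; TUBE♭ ∕ GAP♭ OUTRIGHT AT THE THREE ℤ₂-HOLONOMY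
# SECTORS `ζ_ν := (seam twist of direction ν) 1` OF THE FLAT DATUM

Helper for crux `stmt-QuantumFields-20520` (`Theses.UnitScaleTilt.FluctuationComparisonRegPrIntL`), the (T)-chain of LINE
`semiclassical_s2beta` (cell `ym3-torus`, width seat «width 16» px16 g18).  Sequel of ✓`…S2BetaSeamTwistWords` ∕ ✓`…S2BetaSeamTwistDescent`
(the seam twist `U ↦ fun b => (if b.dir = ν ∧ (b.src ν).val + 1 = N then n1 else 1) * U b` by a central involution `n1` on the WRAPPING bonds of
direction `ν` commutes with `descendTo`, fixes plaquettes, the Wilson action and the good histories) and of ✓`…S2BetaTubeLettersOrbitTransport`.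

* §1 the sup-tube clause and the orbit functional `𝒟(U;U₀) = ⨅_{w} Σ_ℓ dist1 (U ℓ·((w•U₀) ℓ)⁻¹)²` are INVARIANT under
  `(U,U₀) ↦ (tw U, tw U₀)` — with the SAME descent-preserving `w` (`w • tw X = tw (w • X)` since `n1` is central, and the bond quotient
  `(tw U) ℓ·((tw W) ℓ)⁻¹ = U ℓ·(W ℓ)⁻¹` on the nose); the (closed) good fibre over `V` is carried onto the one over `tw V`.
* §2 ★★ `tubeGrowthAt_seamTwist_iff` ∕ ★★ `gapFlatAt_seamTwist_iff`: TUBE♭ ∕ GAP♭ at `(tw V, tw U₀)` ⟺ at `(V, U₀)`, GIVEN the equality of the two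
  regular minima `minActionRegPr … (tw V) = minActionRegPr … V` (displayed as `hmin`; discharged below where used).
* §3 `SU(2)`, `n1 = −1`: the seam sector `ζ_ν := tw 1` is a FLAT connection with holonomy `−1` around the `ν`-cycle — NOT a pure gauge on any period
  (one seam crossing) — `descendTo ζ_ν^K = ζ_ν^J`, `minActionRegPr … ε₀ ζ_ν^J = 0` (✓`regPr_of_flat`), hence ★★★ `exists_tubeGrowth_seamFlat` ∕
  ★★★ `exists_gapFlat_seamFlat` — ✓px12 `exists_tubeGrowth_flat` ∕ `exists_gapFlat_flat` (RECORD 17gc) carried to `(V,U₀) = (ζ_ν^J, ζ_ν^K)` for EVERY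
  direction `ν : Fin 3`, same `γ₁`, same `μ`, NO letter, any `L`.  (Iterating over directions gives the other four sectors `ζ_ε`, `|ε| ≥ 2`; composing
  with ✓(B1) `tubeGrowthAt_gaugeAct_iff` ∕ `gapFlatAt_gaugeAct_iff` at `u := liftTransfTo v` reaches their residual-gauge orbits — next file.)

HONEST: finite-group ∕ topology bookkeeping over landed letters; nothing of Bałaban's analysis; `hmin` displayed in §2; that the seam sectors and
their orbits EXHAUST the central-holonomy stratum of window data is the ℤ₂ normal form (lit ✓`TorusChart.eq_d₀_prim_add_seam_wind`) — NOT typed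
here; this file proves NO stub of the line — TUBE-REG∘ (K-uniform `μ`, universal `δ`), GAP♯∘, EXW∘, S2β and crux 20520 stay OPEN; rung R3 (YM₃ on
T³) is NOT d = 4, NOT infinite volume, NOT a mass gap, NOT Clay; the Yang–Mills mass gap is NOT proved.
-/

set_option autoImplicit false

noncomputable section

open Set Filter Topology Function
open scoped Matrix.Norms.L2Operator
open Literature.MathematicalPhysics.QuantumFieldTheory.Balaban1983to89
open Literature.MathematicalPhysics.QuantumFieldTheory.Balaban1983to89.T3ContinuumYM3Torus
open Literature.MathematicalPhysics.QuantumFieldTheory.Balaban1983to89.T3UnitLawDensityEML (ℰp)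
open Literature.MathematicalPhysics.QuantumFieldTheory.Balaban1983to89.T3UnitScaleTilt
open Literature.MathematicalPhysics.QuantumFieldTheory.Balaban1983to89.T3TiltDescent
open Literature.MathematicalPhysics.QuantumFieldTheory.Balaban1983to89.T3ConstrainedMinimiser (fibre)
open Literature.MathematicalPhysics.QuantumFieldTheory.Balaban1983to89.T3PrintedRegularMinimiser
open Literature.MathematicalPhysics.QuantumFieldTheory.Balaban1983to89.T3PrintedRegularOrbits
open scoped Literature.MathematicalPhysics.QuantumFieldTheory.Balaban1983to89.T3OrbitAverage
open Literature.MathematicalPhysics.QuantumFieldTheory.Balaban1983to89.ExpMeanLog (deltaSU)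
open Summit.QuantumFields.YangMills.Theorems.FluctuationComparisonRegPrIntLS2BetaResidualGauge (gaugeAct_mem_histGood_iff wilsonAction4_gaugeAct)
open Summit.QuantumFields.YangMills.Theorems.FluctuationComparisonRegPrIntLS2BetaResidualGaugeCentral (descendTo_one_eml)
open Summit.QuantumFields.YangMills.Theorems.FluctuationComparisonRegPrIntLRegArgminFlat (regPr_of_flat)
open Summit.QuantumFields.YangMills.Theorems.FluctuationComparisonRegPrIntLS2BetaCriticalOrbitUnique (negOne_mul_comm negOne_mul_negOne)
open Summit.QuantumFields.YangMills.Theorems.BrascampLiebVacuumSC.DimensionGapSU2 (neg_one_mem)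
open Summit.QuantumFields.YangMills.Theorems.FluctuationComparisonRegPrIntLS2BetaFlatGapOutright (exists_tubeGrowth_flat exists_gapFlat_flat)
open Summit.QuantumFields.YangMills.Theorems.FluctuationComparisonRegPrIntLS2BetaSeamTwistWords
open Summit.QuantumFields.YangMills.Theorems.FluctuationComparisonRegPrIntLS2BetaSeamTwistDescent
open Summit.QuantumFields.YangMills.Theorems.FluctuationComparisonRegPrIntLS2BetaTubeLettersOrbitTransport

namespace Summit.QuantumFields.YangMills.Theorems.FluctuationComparisonRegPrIntLS2BetaTubeLettersSeamTwist

variable (F : T3Family) {J K : ℕ} (hJK : J ≤ K)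

/-! ## §1 The tube clause, the orbit functional and the good fibre under the twist -/

/-- **A gauge transformation commutes with the twist** (the twist factor is central). [cite: Balaban1985Averaging, (8) p.19] -/
theorem gaugeAct_seamTwist (n1 : Matrix.specialUnitaryGroup (Fin 2) ℂ) (hc : ∀ g, n1 * g = g * n1) (ν : Fin 3)
    (w : Site (F.P K) 0 → Matrix.specialUnitaryGroup (Fin 2) ℂ) (X : GaugeField (F.P K) 0 (Matrix.specialUnitaryGroup (Fin 2) ℂ)) :
    GaugeField.gaugeAct w (fun b : PBond (F.P K) 0 => (if (b.dir = ν ∧ (b.src ν).val + 1 = (F.P K).sitesPerDir 0) then n1 else 1) * X b) =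
      fun b : PBond (F.P K) 0 => (if (b.dir = ν ∧ (b.src ν).val + 1 = (F.P K).sitesPerDir 0) then n1 else 1) * GaugeField.gaugeAct w X b := by
  funext b
  show w b.src * ((if (b.dir = ν ∧ (b.src ν).val + 1 = (F.P K).sitesPerDir 0) then n1 else 1) * X b) * (w b.tgt)⁻¹ = (if (b.dir = ν ∧ (b.src ν).val + 1 = (F.P K).sitesPerDir 0) then n1 else 1) * (w b.src * X b * (w b.tgt)⁻¹)
  rw [← mul_assoc, ← ite_mul_comm' n1 hc (b.dir = ν ∧ (b.src ν).val + 1 = (F.P K).sitesPerDir 0) (w b.src)]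
  simp only [mul_assoc]

/-- **The bond quotient is twist-invariant on the nose**: `(twist U) ℓ·((twist W) ℓ)⁻¹ = U ℓ·(W ℓ)⁻¹`. [folklore] -/
theorem seamTwist_mul_inv_seamTwist (n1 : Matrix.specialUnitaryGroup (Fin 2) ℂ) (hc : ∀ g, n1 * g = g * n1) (ν : Fin 3)
    (U W : GaugeField (F.P K) 0 (Matrix.specialUnitaryGroup (Fin 2) ℂ)) (ℓ : PBond (F.P K) 0) :
    (if (ℓ.dir = ν ∧ (ℓ.src ν).val + 1 = (F.P K).sitesPerDir 0) then n1 else 1) * U ℓ * ((if (ℓ.dir = ν ∧ (ℓ.src ν).val + 1 = (F.P K).sitesPerDir 0) then n1 else 1) * W ℓ)⁻¹ = U ℓ * (W ℓ)⁻¹ := by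
  calc (if (ℓ.dir = ν ∧ (ℓ.src ν).val + 1 = (F.P K).sitesPerDir 0) then n1 else 1) * U ℓ * ((if (ℓ.dir = ν ∧ (ℓ.src ν).val + 1 = (F.P K).sitesPerDir 0) then n1 else 1) * W ℓ)⁻¹
      = (if (ℓ.dir = ν ∧ (ℓ.src ν).val + 1 = (F.P K).sitesPerDir 0) then n1 else 1) * U ℓ * ((W ℓ)⁻¹ * (if (ℓ.dir = ν ∧ (ℓ.src ν).val + 1 = (F.P K).sitesPerDir 0) then n1 else 1)⁻¹) := by rw [mul_inv_rev]
    _ = (if (ℓ.dir = ν ∧ (ℓ.src ν).val + 1 = (F.P K).sitesPerDir 0) then n1 else 1) * (U ℓ * (W ℓ)⁻¹) * (if (ℓ.dir = ν ∧ (ℓ.src ν).val + 1 = (F.P K).sitesPerDir 0) then n1 else 1)⁻¹ := by simp only [mul_assoc]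
    _ = U ℓ * (W ℓ)⁻¹ * (if (ℓ.dir = ν ∧ (ℓ.src ν).val + 1 = (F.P K).sitesPerDir 0) then n1 else 1) * (if (ℓ.dir = ν ∧ (ℓ.src ν).val + 1 = (F.P K).sitesPerDir 0) then n1 else 1)⁻¹ := by
        rw [ite_mul_comm' n1 hc (ℓ.dir = ν ∧ (ℓ.src ν).val + 1 = (F.P K).sitesPerDir 0) (U ℓ * (W ℓ)⁻¹)]
    _ = U ℓ * (W ℓ)⁻¹ := by rw [mul_assoc, mul_inv_cancel, mul_one]

/-- **THE SUP-TUBE CLAUSE IS TWIST-INVARIANT** (same descent-preserving `w`). [cite: Balaban1985UV3, (12)-(13) p.259] -/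
theorem tube_seamTwist_iff (n1 : Matrix.specialUnitaryGroup (Fin 2) ℂ) (hc : ∀ g, n1 * g = g * n1) (ν : Fin 3)
    (U U₀ : GaugeField (F.P K) 0 (Matrix.specialUnitaryGroup (Fin 2) ℂ)) (δ : ℝ) :
    (∃ w : Site (F.P K) 0 → Matrix.specialUnitaryGroup (Fin 2) ℂ,
        (∀ U'' : GaugeField (F.P K) 0 (Matrix.specialUnitaryGroup (Fin 2) ℂ),
            descendTo F ℰp J K hJK (GaugeField.gaugeAct w U'') = descendTo F ℰp J K hJK U'') ∧
          ∀ ℓ : PBond (F.P K) 0, dist1 ((fun b : PBond (F.P K) 0 => (if (b.dir = ν ∧ (b.src ν).val + 1 = (F.P K).sitesPerDir 0) then n1 else 1) * U b) ℓ *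
            ((GaugeField.gaugeAct w (fun b : PBond (F.P K) 0 => (if (b.dir = ν ∧ (b.src ν).val + 1 = (F.P K).sitesPerDir 0) then n1 else 1) * U₀ b)) ℓ)⁻¹) ≤ δ) ↔
    (∃ w : Site (F.P K) 0 → Matrix.specialUnitaryGroup (Fin 2) ℂ,
        (∀ U'' : GaugeField (F.P K) 0 (Matrix.specialUnitaryGroup (Fin 2) ℂ),
            descendTo F ℰp J K hJK (GaugeField.gaugeAct w U'') = descendTo F ℰp J K hJK U'') ∧
          ∀ ℓ : PBond (F.P K) 0, dist1 (U ℓ * ((GaugeField.gaugeAct w U₀) ℓ)⁻¹) ≤ δ) := by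
  simp only [gaugeAct_seamTwist F n1 hc ν, seamTwist_mul_inv_seamTwist F n1 hc ν]

/-- **THE ORBIT FUNCTIONAL IS TWIST-INVARIANT**: `𝒟(twist U; twist U₀) = 𝒟(U; U₀)`. [cite: Balaban1985UV3, (12)-(13) p.259; Balaban1985Variational, (4) p.278] -/
theorem iInf_orbitDistSq_seamTwist (n1 : Matrix.specialUnitaryGroup (Fin 2) ℂ) (hc : ∀ g, n1 * g = g * n1) (ν : Fin 3)
    (U U₀ : GaugeField (F.P K) 0 (Matrix.specialUnitaryGroup (Fin 2) ℂ)) :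
    (⨅ w : {w : Site (F.P K) 0 → Matrix.specialUnitaryGroup (Fin 2) ℂ |
        ∀ X : GaugeField (F.P K) 0 (Matrix.specialUnitaryGroup (Fin 2) ℂ),
          descendTo F ℰp J K hJK (GaugeField.gaugeAct w X) = descendTo F ℰp J K hJK X},
      ∑ ℓ : PBond (F.P K) 0,
        dist1 ((fun b : PBond (F.P K) 0 => (if (b.dir = ν ∧ (b.src ν).val + 1 = (F.P K).sitesPerDir 0) then n1 else 1) * U b) ℓ *
          ((GaugeField.gaugeAct (w : Site (F.P K) 0 → Matrix.specialUnitaryGroup (Fin 2) ℂ)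
            (fun b : PBond (F.P K) 0 => (if (b.dir = ν ∧ (b.src ν).val + 1 = (F.P K).sitesPerDir 0) then n1 else 1) * U₀ b)) ℓ)⁻¹) ^ 2) =
    (⨅ w : {w : Site (F.P K) 0 → Matrix.specialUnitaryGroup (Fin 2) ℂ |
        ∀ X : GaugeField (F.P K) 0 (Matrix.specialUnitaryGroup (Fin 2) ℂ),
          descendTo F ℰp J K hJK (GaugeField.gaugeAct w X) = descendTo F ℰp J K hJK X},
      ∑ ℓ : PBond (F.P K) 0,
        dist1 (U ℓ * ((GaugeField.gaugeAct (w : Site (F.P K) 0 → Matrix.specialUnitaryGroup (Fin 2) ℂ) U₀) ℓ)⁻¹) ^ 2) := by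
  simp only [gaugeAct_seamTwist F n1 hc ν, seamTwist_mul_inv_seamTwist F n1 hc ν]

/-- **THE GOOD FIBRE IS CARRIED ONTO THE GOOD FIBRE**: `twist U ∈ fibre (twist V) ∩ histGood ⟺ U ∈ fibre V ∩ histGood`.
[cite: Balaban1985Variational, (3) p.278; Balaban1985UV3, (7) p.257] -/
theorem seamTwist_mem_goodFibre_iff (n1 : Matrix.specialUnitaryGroup (Fin 2) ℂ) (hc : ∀ g, n1 * g = g * n1) (hsq : n1 * n1 = 1) (ν : Fin 3)
    {γ b₀ p₀ : ℝ} (V : GaugeField (F.P J) 0 (Matrix.specialUnitaryGroup (Fin 2) ℂ)) (U : GaugeField (F.P K) 0 (Matrix.specialUnitaryGroup (Fin 2) ℂ)) :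
    (fun b : PBond (F.P K) 0 => (if (b.dir = ν ∧ (b.src ν).val + 1 = (F.P K).sitesPerDir 0) then n1 else 1) * U b) ∈
        fibre F ℰp J K hJK (fun c : PBond (F.P J) 0 => (if (c.dir = ν ∧ (c.src ν).val + 1 = (F.P J).sitesPerDir 0) then n1 else 1) * V c) ∩ histGood F ℰp (θBal F.L γ b₀ p₀) K J ↔
      U ∈ fibre F ℰp J K hJK V ∩ histGood F ℰp (θBal F.L γ b₀ p₀) K J := by
  constructor
  · rintro ⟨h1, h2⟩
    exact ⟨(mem_fibre_seamTwist_iff F ℰp n1 hc hsq ν hJK U V).1 h1, (mem_histGood_seamTwist_iff F ℰp n1 hc hsq ν _ J U).1 h2⟩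
  · rintro ⟨h1, h2⟩
    exact ⟨(mem_fibre_seamTwist_iff F ℰp n1 hc hsq ν hJK U V).2 h1, (mem_histGood_seamTwist_iff F ℰp n1 hc hsq ν _ J U).2 h2⟩

/-- The twist as a homeomorphism-style involution of `SU(2)^{bonds}`: it is continuous. [folklore] -/
theorem continuous_seamTwist (n1 : Matrix.specialUnitaryGroup (Fin 2) ℂ) (ν : Fin 3) :
    Continuous fun U : GaugeField (F.P K) 0 (Matrix.specialUnitaryGroup (Fin 2) ℂ) =>
      (fun b : PBond (F.P K) 0 => (if (b.dir = ν ∧ (b.src ν).val + 1 = (F.P K).sitesPerDir 0) then n1 else 1) * U b) := by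
  refine continuous_pi fun b => ?_
  exact continuous_const.mul (continuous_apply b)

/-- The good fibre over `twist V` IS the twist-image of the good fibre over `V`. [cite: Balaban1985Variational, (3) p.278] -/
theorem goodFibre_seamTwist_eq_image (n1 : Matrix.specialUnitaryGroup (Fin 2) ℂ) (hc : ∀ g, n1 * g = g * n1) (hsq : n1 * n1 = 1) (ν : Fin 3)
    {γ b₀ p₀ : ℝ} (V : GaugeField (F.P J) 0 (Matrix.specialUnitaryGroup (Fin 2) ℂ)) :
    fibre F ℰp J K hJK (fun c : PBond (F.P J) 0 => (if (c.dir = ν ∧ (c.src ν).val + 1 = (F.P J).sitesPerDir 0) then n1 else 1) * V c) ∩ histGood F ℰp (θBal F.L γ b₀ p₀) K J =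
      (fun U : GaugeField (F.P K) 0 (Matrix.specialUnitaryGroup (Fin 2) ℂ) =>
        (fun b : PBond (F.P K) 0 => (if (b.dir = ν ∧ (b.src ν).val + 1 = (F.P K).sitesPerDir 0) then n1 else 1) * U b)) ''
        (fibre F ℰp J K hJK V ∩ histGood F ℰp (θBal F.L γ b₀ p₀) K J) := by
  ext U
  constructor
  · intro hU
    refine ⟨fun b => (if (b.dir = ν ∧ (b.src ν).val + 1 = (F.P K).sitesPerDir 0) then n1 else 1) * U b, ?_, seamTwist_seamTwist (P := F.P K) n1 hsq ν U⟩
    rw [← seamTwist_mem_goodFibre_iff F hJK n1 hc hsq ν, seamTwist_seamTwist (P := F.P K) n1 hsq ν U]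
    exact hU
  · rintro ⟨W, hW, rfl⟩
    exact (seamTwist_mem_goodFibre_iff F hJK n1 hc hsq ν V W).2 hW

/-- … and so is its closure. [cite: Balaban1985Variational, (3) p.278] -/
theorem mem_closure_goodFibre_seamTwist_iff (n1 : Matrix.specialUnitaryGroup (Fin 2) ℂ) (hc : ∀ g, n1 * g = g * n1) (hsq : n1 * n1 = 1)
    (ν : Fin 3) {γ b₀ p₀ : ℝ} (V : GaugeField (F.P J) 0 (Matrix.specialUnitaryGroup (Fin 2) ℂ))
    (U : GaugeField (F.P K) 0 (Matrix.specialUnitaryGroup (Fin 2) ℂ)) :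
    (fun b : PBond (F.P K) 0 => (if (b.dir = ν ∧ (b.src ν).val + 1 = (F.P K).sitesPerDir 0) then n1 else 1) * U b) ∈
        closure (fibre F ℰp J K hJK (fun c : PBond (F.P J) 0 => (if (c.dir = ν ∧ (c.src ν).val + 1 = (F.P J).sitesPerDir 0) then n1 else 1) * V c) ∩ histGood F ℰp (θBal F.L γ b₀ p₀) K J) ↔
      U ∈ closure (fibre F ℰp J K hJK V ∩ histGood F ℰp (θBal F.L γ b₀ p₀) K J) := by
  let φ : GaugeField (F.P K) 0 (Matrix.specialUnitaryGroup (Fin 2) ℂ) ≃ₜ GaugeField (F.P K) 0 (Matrix.specialUnitaryGroup (Fin 2) ℂ) :=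
    { toFun := fun U => fun b : PBond (F.P K) 0 => (if (b.dir = ν ∧ (b.src ν).val + 1 = (F.P K).sitesPerDir 0) then n1 else 1) * U b
      invFun := fun U => fun b : PBond (F.P K) 0 => (if (b.dir = ν ∧ (b.src ν).val + 1 = (F.P K).sitesPerDir 0) then n1 else 1) * U b
      left_inv := fun X => seamTwist_seamTwist (P := F.P K) n1 hsq ν X
      right_inv := fun X => seamTwist_seamTwist (P := F.P K) n1 hsq ν X
      continuous_toFun := continuous_seamTwist F n1 ν
      continuous_invFun := continuous_seamTwist F n1 ν }
  rw [goodFibre_seamTwist_eq_image F hJK n1 hc hsq ν V]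
  change φ U ∈ closure (φ '' (fibre F ℰp J K hJK V ∩ histGood F ℰp (θBal F.L γ b₀ p₀) K J)) ↔ _
  rw [← φ.image_closure, φ.injective.mem_set_image]

/-! ## §2 TUBE♭ and GAP♭ under the twist, given the equality of the regular minima -/

/-- ★★ **TUBE♭ IS TWIST-INVARIANT** given `hmin` (radius `δ`, constant `c`; texts = ✓brick 5 ∕ ✓p799103 bodies with `(1,1) ↦ (V,U₀)`).
[cite: Balaban1985Variational, (142) p.299; Balaban1985UV3, (18)-(22) p.260] -/
theorem tubeGrowthAt_seamTwist_iff (n1 : Matrix.specialUnitaryGroup (Fin 2) ℂ) (hc : ∀ g, n1 * g = g * n1) (hsq : n1 * n1 = 1) (ν : Fin 3)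
    {γ b₀ p₀ ε₀ : ℝ} (V : GaugeField (F.P J) 0 (Matrix.specialUnitaryGroup (Fin 2) ℂ)) (U₀ : GaugeField (F.P K) 0 (Matrix.specialUnitaryGroup (Fin 2) ℂ))
    (hmin : minActionRegPr F J K hJK ε₀ (fun c : PBond (F.P J) 0 => (if (c.dir = ν ∧ (c.src ν).val + 1 = (F.P J).sitesPerDir 0) then n1 else 1) * V c) = minActionRegPr F J K hJK ε₀ V)
    (δ c : ℝ) :
    (∀ U ∈ fibre F ℰp J K hJK (fun c : PBond (F.P J) 0 => (if (c.dir = ν ∧ (c.src ν).val + 1 = (F.P J).sitesPerDir 0) then n1 else 1) * V c), U ∈ histGood F ℰp (θBal F.L γ b₀ p₀) K J →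
      (∃ w : Site (F.P K) 0 → Matrix.specialUnitaryGroup (Fin 2) ℂ,
        (∀ U'' : GaugeField (F.P K) 0 (Matrix.specialUnitaryGroup (Fin 2) ℂ),
          descendTo F ℰp J K hJK (GaugeField.gaugeAct w U'') = descendTo F ℰp J K hJK U'') ∧
        ∀ ℓ : PBond (F.P K) 0, dist1 (U ℓ * ((GaugeField.gaugeAct w
          (fun b : PBond (F.P K) 0 => (if (b.dir = ν ∧ (b.src ν).val + 1 = (F.P K).sitesPerDir 0) then n1 else 1) * U₀ b)) ℓ)⁻¹) ≤ δ) →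
      c * ((F.L : ℝ)⁻¹) ^ (2 * (K - J)) *
        (⨅ w : {w : Site (F.P K) 0 → Matrix.specialUnitaryGroup (Fin 2) ℂ |
            ∀ U : GaugeField (F.P K) 0 (Matrix.specialUnitaryGroup (Fin 2) ℂ),
              descendTo F ℰp J K hJK (GaugeField.gaugeAct w U) = descendTo F ℰp J K hJK U},
          ∑ ℓ : PBond (F.P K) 0,
            dist1 (U ℓ * ((GaugeField.gaugeAct (w : Site (F.P K) 0 → Matrix.specialUnitaryGroup (Fin 2) ℂ)
              (fun b : PBond (F.P K) 0 => (if (b.dir = ν ∧ (b.src ν).val + 1 = (F.P K).sitesPerDir 0) then n1 else 1) * U₀ b)) ℓ)⁻¹) ^ 2)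
        ≤ wilsonAction4 U - minActionRegPr F J K hJK ε₀ (fun c : PBond (F.P J) 0 => (if (c.dir = ν ∧ (c.src ν).val + 1 = (F.P J).sitesPerDir 0) then n1 else 1) * V c)) ↔
    (∀ U ∈ fibre F ℰp J K hJK V, U ∈ histGood F ℰp (θBal F.L γ b₀ p₀) K J →
      (∃ w : Site (F.P K) 0 → Matrix.specialUnitaryGroup (Fin 2) ℂ,
        (∀ U'' : GaugeField (F.P K) 0 (Matrix.specialUnitaryGroup (Fin 2) ℂ),
          descendTo F ℰp J K hJK (GaugeField.gaugeAct w U'') = descendTo F ℰp J K hJK U'') ∧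
        ∀ ℓ : PBond (F.P K) 0, dist1 (U ℓ * ((GaugeField.gaugeAct w U₀) ℓ)⁻¹) ≤ δ) →
      c * ((F.L : ℝ)⁻¹) ^ (2 * (K - J)) *
        (⨅ w : {w : Site (F.P K) 0 → Matrix.specialUnitaryGroup (Fin 2) ℂ |
            ∀ U : GaugeField (F.P K) 0 (Matrix.specialUnitaryGroup (Fin 2) ℂ),
              descendTo F ℰp J K hJK (GaugeField.gaugeAct w U) = descendTo F ℰp J K hJK U},
          ∑ ℓ : PBond (F.P K) 0,
            dist1 (U ℓ * ((GaugeField.gaugeAct (w : Site (F.P K) 0 → Matrix.specialUnitaryGroup (Fin 2) ℂ) U₀) ℓ)⁻¹) ^ 2)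
        ≤ wilsonAction4 U - minActionRegPr F J K hJK ε₀ V) := by
  rw [hmin]
  constructor
  · intro h U hUf hUh htube
    have hU' := (seamTwist_mem_goodFibre_iff F hJK n1 hc hsq ν (γ := γ) (b₀ := b₀) (p₀ := p₀) V U).2 ⟨hUf, hUh⟩
    have h1 := h _ hU'.1 hU'.2 ((tube_seamTwist_iff F hJK n1 hc ν U U₀ δ).2 htube)
    rwa [iInf_orbitDistSq_seamTwist F hJK n1 hc ν, wilsonAction4_seamTwist (P := F.P K) n1 hc ν] at h1
  · intro h U hUf hUh htube
    obtain ⟨W, rfl⟩ : ∃ W : GaugeField (F.P K) 0 (Matrix.specialUnitaryGroup (Fin 2) ℂ),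
        U = fun b : PBond (F.P K) 0 => (if (b.dir = ν ∧ (b.src ν).val + 1 = (F.P K).sitesPerDir 0) then n1 else 1) * W b :=
      ⟨fun b => (if (b.dir = ν ∧ (b.src ν).val + 1 = (F.P K).sitesPerDir 0) then n1 else 1) * U b, (seamTwist_seamTwist (P := F.P K) n1 hsq ν U).symm⟩
    have hW := (seamTwist_mem_goodFibre_iff F hJK n1 hc hsq ν (γ := γ) (b₀ := b₀) (p₀ := p₀) V W).1 ⟨hUf, hUh⟩
    have h1 := h W hW.1 hW.2 ((tube_seamTwist_iff F hJK n1 hc ν W U₀ δ).1 htube)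
    rwa [iInf_orbitDistSq_seamTwist F hJK n1 hc ν, wilsonAction4_seamTwist (P := F.P K) n1 hc ν]

/-- ★★ **GAP♭ IS TWIST-INVARIANT** given `hmin`. [cite: Balaban1985Variational, (142) p.299; Balaban1984PropagatorsII, (1.33)] -/
theorem gapFlatAt_seamTwist_iff (n1 : Matrix.specialUnitaryGroup (Fin 2) ℂ) (hc : ∀ g, n1 * g = g * n1) (hsq : n1 * n1 = 1) (ν : Fin 3)
    {γ b₀ p₀ ε₀ : ℝ} (V : GaugeField (F.P J) 0 (Matrix.specialUnitaryGroup (Fin 2) ℂ)) (U₀ : GaugeField (F.P K) 0 (Matrix.specialUnitaryGroup (Fin 2) ℂ))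
    (hmin : minActionRegPr F J K hJK ε₀ (fun c : PBond (F.P J) 0 => (if (c.dir = ν ∧ (c.src ν).val + 1 = (F.P J).sitesPerDir 0) then n1 else 1) * V c) = minActionRegPr F J K hJK ε₀ V)
    (c : ℝ) :
    (∀ U ∈ fibre F ℰp J K hJK (fun c : PBond (F.P J) 0 => (if (c.dir = ν ∧ (c.src ν).val + 1 = (F.P J).sitesPerDir 0) then n1 else 1) * V c), U ∈ histGood F ℰp (θBal F.L γ b₀ p₀) K J →
      c * ((F.L : ℝ)⁻¹) ^ (2 * (K - J)) *
        (⨅ w : {w : Site (F.P K) 0 → Matrix.specialUnitaryGroup (Fin 2) ℂ |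
            ∀ U : GaugeField (F.P K) 0 (Matrix.specialUnitaryGroup (Fin 2) ℂ),
              descendTo F ℰp J K hJK (GaugeField.gaugeAct w U) = descendTo F ℰp J K hJK U},
          ∑ ℓ : PBond (F.P K) 0,
            dist1 (U ℓ * ((GaugeField.gaugeAct (w : Site (F.P K) 0 → Matrix.specialUnitaryGroup (Fin 2) ℂ)
              (fun b : PBond (F.P K) 0 => (if (b.dir = ν ∧ (b.src ν).val + 1 = (F.P K).sitesPerDir 0) then n1 else 1) * U₀ b)) ℓ)⁻¹) ^ 2)
        ≤ wilsonAction4 U - minActionRegPr F J K hJK ε₀ (fun c : PBond (F.P J) 0 => (if (c.dir = ν ∧ (c.src ν).val + 1 = (F.P J).sitesPerDir 0) then n1 else 1) * V c)) ↔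
    (∀ U ∈ fibre F ℰp J K hJK V, U ∈ histGood F ℰp (θBal F.L γ b₀ p₀) K J →
      c * ((F.L : ℝ)⁻¹) ^ (2 * (K - J)) *
        (⨅ w : {w : Site (F.P K) 0 → Matrix.specialUnitaryGroup (Fin 2) ℂ |
            ∀ U : GaugeField (F.P K) 0 (Matrix.specialUnitaryGroup (Fin 2) ℂ),
              descendTo F ℰp J K hJK (GaugeField.gaugeAct w U) = descendTo F ℰp J K hJK U},
          ∑ ℓ : PBond (F.P K) 0,
            dist1 (U ℓ * ((GaugeField.gaugeAct (w : Site (F.P K) 0 → Matrix.specialUnitaryGroup (Fin 2) ℂ) U₀) ℓ)⁻¹) ^ 2)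
        ≤ wilsonAction4 U - minActionRegPr F J K hJK ε₀ V) := by
  rw [hmin]
  constructor
  · intro h U hUf hUh
    have hU' := (seamTwist_mem_goodFibre_iff F hJK n1 hc hsq ν (γ := γ) (b₀ := b₀) (p₀ := p₀) V U).2 ⟨hUf, hUh⟩
    have h1 := h _ hU'.1 hU'.2
    rwa [iInf_orbitDistSq_seamTwist F hJK n1 hc ν, wilsonAction4_seamTwist (P := F.P K) n1 hc ν] at h1
  · intro h U hUf hUh
    obtain ⟨W, rfl⟩ : ∃ W : GaugeField (F.P K) 0 (Matrix.specialUnitaryGroup (Fin 2) ℂ),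
        U = fun b : PBond (F.P K) 0 => (if (b.dir = ν ∧ (b.src ν).val + 1 = (F.P K).sitesPerDir 0) then n1 else 1) * W b :=
      ⟨fun b => (if (b.dir = ν ∧ (b.src ν).val + 1 = (F.P K).sitesPerDir 0) then n1 else 1) * U b, (seamTwist_seamTwist (P := F.P K) n1 hsq ν U).symm⟩
    have hW := (seamTwist_mem_goodFibre_iff F hJK n1 hc hsq ν (γ := γ) (b₀ := b₀) (p₀ := p₀) V W).1 ⟨hUf, hUh⟩
    have h1 := h W hW.1 hW.2
    rwa [iInf_orbitDistSq_seamTwist F hJK n1 hc ν, wilsonAction4_seamTwist (P := F.P K) n1 hc ν]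

/-! ## §3 `SU(2)`: the ℤ₂-holonomy sectors of the flat datum — TUBE♭ ∕ GAP♭ OUTRIGHT there -/

/-- The twisted flat fine field is FLAT (every plaquette variable is `1`). [folklore] -/
theorem plaqHol_seamTwist_one (ν : Fin 3) (p : Plaq (F.P K) 0) :
    GaugeField.plaqHol (fun b : PBond (F.P K) 0 => (if (b.dir = ν ∧ (b.src ν).val + 1 = (F.P K).sitesPerDir 0) then (⟨-1, neg_one_mem⟩ : Matrix.specialUnitaryGroup (Fin 2) ℂ) else 1) *
      (1 : GaugeField (F.P K) 0 (Matrix.specialUnitaryGroup (Fin 2) ℂ)) b) p = 1 := by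
  rw [plaqHol_seamTwist (P := F.P K) _ negOne_mul_comm ν]
  show (1 : Matrix.specialUnitaryGroup (Fin 2) ℂ) * 1 * 1⁻¹ * 1⁻¹ = 1
  group

/-- **THE TWISTED FLAT FINE FIELD LIES OVER THE TWISTED FLAT DATUM** (`D_{J,K}` commutes with the twist, `D_{J,K} 1 = 1`). [cite: Balaban1987RG1, (0.11) p.253] -/
theorem descendTo_seamTwist_one (ν : Fin 3) :
    descendTo F ℰp J K hJK (fun b : PBond (F.P K) 0 => (if (b.dir = ν ∧ (b.src ν).val + 1 = (F.P K).sitesPerDir 0) then (⟨-1, neg_one_mem⟩ : Matrix.specialUnitaryGroup (Fin 2) ℂ) else 1) *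
      (1 : GaugeField (F.P K) 0 (Matrix.specialUnitaryGroup (Fin 2) ℂ)) b) =
      fun c : PBond (F.P J) 0 => (if (c.dir = ν ∧ (c.src ν).val + 1 = (F.P J).sitesPerDir 0) then (⟨-1, neg_one_mem⟩ : Matrix.specialUnitaryGroup (Fin 2) ℂ) else 1) *
        (1 : GaugeField (F.P J) 0 (Matrix.specialUnitaryGroup (Fin 2) ℂ)) c := by
  rw [descendTo_seamTwist F ℰp _ negOne_mul_comm negOne_mul_negOne ν hJK, descendTo_one_eml F hJK]

/-- **THE REGULAR MINIMUM OVER A TWISTED FLAT DATUM VANISHES** (`ε₀ > 0`): the twisted flat fine field is flat, hence (6)-regular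
(✓`regPr_of_flat`), lies over the twisted flat datum, and has zero action. [cite: Balaban1985Variational, (5)-(6) p.278, Thm 1 (8) p.279] -/
theorem minActionRegPr_seamTwist_one {ε₀ : ℝ} (hε₀ : 0 < ε₀) (ν : Fin 3) :
    minActionRegPr F J K hJK ε₀ (fun c : PBond (F.P J) 0 =>
      (if (c.dir = ν ∧ (c.src ν).val + 1 = (F.P J).sitesPerDir 0) then (⟨-1, neg_one_mem⟩ : Matrix.specialUnitaryGroup (Fin 2) ℂ) else 1) *
        (1 : GaugeField (F.P J) 0 (Matrix.specialUnitaryGroup (Fin 2) ℂ)) c) = 0 := by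
  have hmem : (fun b : PBond (F.P K) 0 => (if (b.dir = ν ∧ (b.src ν).val + 1 = (F.P K).sitesPerDir 0) then (⟨-1, neg_one_mem⟩ : Matrix.specialUnitaryGroup (Fin 2) ℂ) else 1) *
      (1 : GaugeField (F.P K) 0 (Matrix.specialUnitaryGroup (Fin 2) ℂ)) b) ∈
      regFibrePr F J K hJK ε₀ (fun c : PBond (F.P J) 0 =>
        (if (c.dir = ν ∧ (c.src ν).val + 1 = (F.P J).sitesPerDir 0) then (⟨-1, neg_one_mem⟩ : Matrix.specialUnitaryGroup (Fin 2) ℂ) else 1) *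
          (1 : GaugeField (F.P J) 0 (Matrix.specialUnitaryGroup (Fin 2) ℂ)) c) :=
    (mem_regFibrePr_iff F).2 ⟨descendTo_seamTwist_one F hJK ν, regPr_of_flat F hε₀ (plaqHol_seamTwist_one F ν)⟩
  have hA : wilsonAction4 (fun b : PBond (F.P K) 0 => (if (b.dir = ν ∧ (b.src ν).val + 1 = (F.P K).sitesPerDir 0) then (⟨-1, neg_one_mem⟩ : Matrix.specialUnitaryGroup (Fin 2) ℂ) else 1) *
      (1 : GaugeField (F.P K) 0 (Matrix.specialUnitaryGroup (Fin 2) ℂ)) b) = 0 := by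
    rw [wilsonAction4_seamTwist (P := F.P K) _ negOne_mul_comm ν]
    exact T3Thm1CarrierNative.wilsonAction4_one_eq_zero
  exact le_antisymm ((minActionRegPr_le F hmem).trans_eq hA) (minActionRegPr_nonneg F _)

/-- `hmin` at the flat datum: both regular minima vanish. [cite: Balaban1985Variational, Thm 1 (8) p.279] -/
theorem minActionRegPr_seamTwist_one_eq {ε₀ : ℝ} (hε₀ : 0 < ε₀) (ν : Fin 3) :
    minActionRegPr F J K hJK ε₀ (fun c : PBond (F.P J) 0 =>
      (if (c.dir = ν ∧ (c.src ν).val + 1 = (F.P J).sitesPerDir 0) then (⟨-1, neg_one_mem⟩ : Matrix.specialUnitaryGroup (Fin 2) ℂ) else 1) *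
        (1 : GaugeField (F.P J) 0 (Matrix.specialUnitaryGroup (Fin 2) ℂ)) c) =
      minActionRegPr F J K hJK ε₀ (1 : GaugeField (F.P J) 0 (Matrix.specialUnitaryGroup (Fin 2) ℂ)) := by
  rw [minActionRegPr_seamTwist_one F hJK hε₀ ν, minActionRegPr_one F hε₀]

/-- ★★★ **TUBE♭ OUTRIGHT AT EVERY SEAM SECTOR `(ζ_ν^J, ζ_ν^K)` OF THE FLAT DATUM** (`ζ_ν := −1` on the wrapping bonds of direction `ν`, `1` elsewhere; every `δ`;
the SAME `γ₁` and, per `(F, γ, J, K, ε₀, δ)`, the SAME `μ` as ✓px12 `exists_tubeGrowth_flat` at `(1,1)`).  NO letter.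
[cite: Balaban1985Variational, (142) p.299, Thm 1 (8) p.279; Balaban1985UV3, (12)-(13) p.259, (18)-(22) p.260] -/
theorem exists_tubeGrowth_seamFlat (L : ℕ) (b₀ p₀ : ℝ) (hb : 0 < b₀) (hp : 0 < p₀) :
    ∃ γ₁ : ℝ, 0 < γ₁ ∧ ∀ (F : T3Family) (γ : ℝ), F.L = L → 0 < γ → γ ≤ γ₁ →
      ∀ (J K : ℕ) (hlt : J < K) (hk : K - J ≤ (F.P K).m + (F.P K).K)
        (ε₀ : ℝ), 0 < ε₀ → (143 * ((((3 + 4 : ℕ) : ℝ)) ^ 2 / 4) ^ 2) * (2 * ε₀) ≤ 1 / 3 →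
          2 * (2 * ε₀) ≤ 2 * deltaSU (Fin 2) / (((3 + 4) * F.L : ℕ) : ℝ) ^ 2 →
        ∀ (ν : Fin 3) (δ : ℝ),
          ∃ μ : ℝ, 0 < μ ∧ ∀ U ∈ fibre F ℰp J K hlt.le (fun c : PBond (F.P J) 0 =>
              (if (c.dir = ν ∧ (c.src ν).val + 1 = (F.P J).sitesPerDir 0) then (⟨-1, neg_one_mem⟩ : Matrix.specialUnitaryGroup (Fin 2) ℂ) else 1) *
                (1 : GaugeField (F.P J) 0 (Matrix.specialUnitaryGroup (Fin 2) ℂ)) c),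
            U ∈ histGood F ℰp (θBal F.L γ b₀ p₀) K J →
          (∃ w : Site (F.P K) 0 → Matrix.specialUnitaryGroup (Fin 2) ℂ,
          (∀ U'' : GaugeField (F.P K) 0 (Matrix.specialUnitaryGroup (Fin 2) ℂ),
          descendTo F ℰp J K hlt.le (GaugeField.gaugeAct w U'') = descendTo F ℰp J K hlt.le U'') ∧
          ∀ ℓ : PBond (F.P K) 0, dist1 (U ℓ * ((GaugeField.gaugeAct w
            (fun b : PBond (F.P K) 0 => (if (b.dir = ν ∧ (b.src ν).val + 1 = (F.P K).sitesPerDir 0) then (⟨-1, neg_one_mem⟩ : Matrix.specialUnitaryGroup (Fin 2) ℂ) else 1) *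
              (1 : GaugeField (F.P K) 0 (Matrix.specialUnitaryGroup (Fin 2) ℂ)) b)) ℓ)⁻¹) ≤ δ) →
          μ * ((F.L : ℝ)⁻¹) ^ (2 * (K - J)) *
          (⨅ w : {w : Site (F.P K) 0 → Matrix.specialUnitaryGroup (Fin 2) ℂ |
          ∀ U : GaugeField (F.P K) 0 (Matrix.specialUnitaryGroup (Fin 2) ℂ),
          descendTo F ℰp J K hlt.le (GaugeField.gaugeAct w U) = descendTo F ℰp J K hlt.le U},
          ∑ ℓ : PBond (F.P K) 0,
          dist1 (U ℓ * ((GaugeField.gaugeAct (w : Site (F.P K) 0 → Matrix.specialUnitaryGroup (Fin 2) ℂ)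
            (fun b : PBond (F.P K) 0 => (if (b.dir = ν ∧ (b.src ν).val + 1 = (F.P K).sitesPerDir 0) then (⟨-1, neg_one_mem⟩ : Matrix.specialUnitaryGroup (Fin 2) ℂ) else 1) *
              (1 : GaugeField (F.P K) 0 (Matrix.specialUnitaryGroup (Fin 2) ℂ)) b)) ℓ)⁻¹) ^ 2)
          ≤ wilsonAction4 U - minActionRegPr F J K hlt.le ε₀ (fun c : PBond (F.P J) 0 =>
              (if (c.dir = ν ∧ (c.src ν).val + 1 = (F.P J).sitesPerDir 0) then (⟨-1, neg_one_mem⟩ : Matrix.specialUnitaryGroup (Fin 2) ℂ) else 1) *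
                (1 : GaugeField (F.P J) 0 (Matrix.specialUnitaryGroup (Fin 2) ℂ)) c) := by
  obtain ⟨γ₁, hγ₁, hmain⟩ := exists_tubeGrowth_flat L b₀ p₀ hb hp
  refine ⟨γ₁, hγ₁, ?_⟩
  intro F γ hFL hγ hγle J K hlt hk ε₀ hε₀ hr3 hr2 ν δ
  obtain ⟨μ, hμ, htube⟩ := hmain F γ hFL hγ hγle J K hlt hk ε₀ hε₀ hr3 hr2 δ
  exact ⟨μ, hμ, (tubeGrowthAt_seamTwist_iff F hlt.le _ negOne_mul_comm negOne_mul_negOne ν (γ := γ) (b₀ := b₀) (p₀ := p₀) 1 1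
    (minActionRegPr_seamTwist_one_eq F hlt.le hε₀ ν) δ μ).2 htube⟩

/-- ★★★ **GAP♭ OUTRIGHT AT EVERY SEAM SECTOR `(ζ_ν^J, ζ_ν^K)` OF THE FLAT DATUM** (`γ ≤ γ₁(L, b₀, p₀, δ)` — the SAME `γ₁` as ✓px12
`exists_gapFlat_flat`, same `μ`).  NO letter. [cite: Balaban1985Variational, (142) p.299, Thm 1 (8) p.279; Balaban1984PropagatorsII, (1.33); Balaban1985UV3, (12)-(13) p.259] -/
theorem exists_gapFlat_seamFlat (L : ℕ) (b₀ p₀ : ℝ) (hb : 0 < b₀) (hp : 0 < p₀) (δ : ℝ) (hδ : 0 < δ) :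
    ∃ γ₁ : ℝ, 0 < γ₁ ∧ ∀ (F : T3Family) (γ : ℝ), F.L = L → 0 < γ → γ ≤ γ₁ →
      ∀ (J K : ℕ) (hlt : J < K) (hk : K - J ≤ (F.P K).m + (F.P K).K)
        (ε₀ : ℝ), 0 < ε₀ → (143 * ((((3 + 4 : ℕ) : ℝ)) ^ 2 / 4) ^ 2) * (2 * ε₀) ≤ 1 / 3 →
          2 * (2 * ε₀) ≤ 2 * deltaSU (Fin 2) / (((3 + 4) * F.L : ℕ) : ℝ) ^ 2 →
        ∀ ν : Fin 3,
        ∃ μ : ℝ, 0 < μ ∧ ∀ U ∈ fibre F ℰp J K hlt.le (fun c : PBond (F.P J) 0 =>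
              (if (c.dir = ν ∧ (c.src ν).val + 1 = (F.P J).sitesPerDir 0) then (⟨-1, neg_one_mem⟩ : Matrix.specialUnitaryGroup (Fin 2) ℂ) else 1) *
                (1 : GaugeField (F.P J) 0 (Matrix.specialUnitaryGroup (Fin 2) ℂ)) c),
          U ∈ histGood F ℰp (θBal F.L γ b₀ p₀) K J →
        μ * ((F.L : ℝ)⁻¹) ^ (2 * (K - J)) *
        (⨅ w : {w : Site (F.P K) 0 → Matrix.specialUnitaryGroup (Fin 2) ℂ |
        ∀ U : GaugeField (F.P K) 0 (Matrix.specialUnitaryGroup (Fin 2) ℂ),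
        descendTo F ℰp J K hlt.le (GaugeField.gaugeAct w U) = descendTo F ℰp J K hlt.le U},
        ∑ ℓ : PBond (F.P K) 0,
        dist1 (U ℓ * ((GaugeField.gaugeAct (w : Site (F.P K) 0 → Matrix.specialUnitaryGroup (Fin 2) ℂ)
          (fun b : PBond (F.P K) 0 => (if (b.dir = ν ∧ (b.src ν).val + 1 = (F.P K).sitesPerDir 0) then (⟨-1, neg_one_mem⟩ : Matrix.specialUnitaryGroup (Fin 2) ℂ) else 1) *
            (1 : GaugeField (F.P K) 0 (Matrix.specialUnitaryGroup (Fin 2) ℂ)) b)) ℓ)⁻¹) ^ 2)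
        ≤ wilsonAction4 U - minActionRegPr F J K hlt.le ε₀ (fun c : PBond (F.P J) 0 =>
              (if (c.dir = ν ∧ (c.src ν).val + 1 = (F.P J).sitesPerDir 0) then (⟨-1, neg_one_mem⟩ : Matrix.specialUnitaryGroup (Fin 2) ℂ) else 1) *
                (1 : GaugeField (F.P J) 0 (Matrix.specialUnitaryGroup (Fin 2) ℂ)) c) := by
  obtain ⟨γ₁, hγ₁, hmain⟩ := exists_gapFlat_flat L b₀ p₀ hb hp δ hδ
  refine ⟨γ₁, hγ₁, ?_⟩
  intro F γ hFL hγ hγle J K hlt hk ε₀ hε₀ hr3 hr2 ν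
  obtain ⟨μ, hμ, hgap⟩ := hmain F γ hFL hγ hγle J K hlt hk ε₀ hε₀ hr3 hr2
  exact ⟨μ, hμ, (gapFlatAt_seamTwist_iff F hlt.le _ negOne_mul_comm negOne_mul_negOne ν (γ := γ) (b₀ := b₀) (p₀ := p₀) 1 1
    (minActionRegPr_seamTwist_one_eq F hlt.le hε₀ ν) μ).2 hgap⟩

end Summit.QuantumFields.YangMills.Theorems.FluctuationComparisonRegPrIntLS2BetaTubeLettersSeamTwist

end
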